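import Summits.QuantumFields.YangMills.Theorems.RationalShortRootRigidityDihedralChevalley
import HarnessLib

/-!
# `RationalShortRootRigidity` — Step 2 assembly helpers: the planar frame (parts A/B and G of the `stub_planar` plan)

Helper lemmas INSIDE the paper proof of crux `stmt-QuantumFields-23124` (`F4SubCurvatureDoor.RationalShortRootRigidity`,
LINE g15-A of planner ym-idea-3; owner's assembly plan HOME l15/STUB-PLAN-Planar.md for the birth skeleton's `stub_planar`).
Coordinates on the 60° plane `Π = span(e₀, f)`, `f = (0,1,1,1)/√3`: a point is `x e₀ + y f + q₀` with `q₀ ∈ Π^⊥ = {q₀ 0 = 0, q₀ 1 + q₀ 2 + q₀ 3 = 0}`,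
written `fun i => if i = 0 then x else y/√3 + q₀ i` (only `q₀ 1 + q₀ 2 + q₀ 3 = 0` matters; `q₀ 0` is never read).

* `planar_restriction_dihedral` (plan §A–B): for `D` invariant under `W(B₄)` and the half-reflection (the crux's `IsB4Inv`, `IsHalfInv`, unfolded),
  every planar restriction `b_{q₀}(x,y) = D(x e₀ + y f + q₀)` is even in `x` and invariant under the rotation by `120°` (`= s ∘ ε₀` on `Π`), hence
  — by the tree lemma `dihedralChevalley` (p663895) — a polynomial in `u₂ = x² + y²`, `u₃ = 3x²y − y³`.
* `planeRotInv_of_planar_radial` (plan §G): if every planar restriction is a polynomial in `x² + y²` alone, then `D` is invariant under the plane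
  rotations `rotPlane φ` (conclusion = the skeleton's `PlaneRotInv D` with `rotPlane` inlined, verbatim the hypothesis `hrot` of the tree theorem
  `radial_of_b4Inv_of_planeRotInv`, p660676).

What remains for `stub_planar` (plan §C–F: degree bookkeeping of the Chevalley polynomial, the top form via `mobiusTopForm` p665007 and
`rootsInClosedSetLimit` p666193, and `noU3Lemma` p668537) is NOT done here.  Mathlib + the tree lemma `dihedralChevalley`; THEOREMS ONLY; no
named facts; no `sorry`; default heartbeats.  Nothing about the crux 23124, the route's rung or the Yang–Mills mass gap is proved here.  Free-hands
seat `ym-line-frs-p2` g10, `--supports stmt-QuantumFields-23124`.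
-/

set_option autoImplicit false

namespace Summit.QuantumFields.YangMills.Theorems.RationalShortRootRigidity

open scoped BigOperators

/-- **Planar restrictions are `D₃`-symmetric, hence polynomials in `u₂, u₃`** (plan §A–B). [folklore] -/
theorem planar_restriction_dihedral (D : MvPolynomial (Fin 4) ℝ)
    (hB4 : ∀ (σ : Equiv.Perm (Fin 4)) (ε : Fin 4 → ℝ), (∀ i, ε i = 1 ∨ ε i = -1) →
      ∀ p : Fin 4 → ℝ, MvPolynomial.eval (fun i => ε i * p (σ i)) D = MvPolynomial.eval p D)
    (hhalf : ∀ p : Fin 4 → ℝ, MvPolynomial.eval (fun i => p i - (∑ j, p j) / 2) D = MvPolynomial.eval p D)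
    (q₀ : Fin 4 → ℝ) (hqs : q₀ 1 + q₀ 2 + q₀ 3 = 0) :
    ∃ c : MvPolynomial (Fin 2) ℝ, ∀ x y : ℝ,
      MvPolynomial.eval (fun i : Fin 4 => if i = 0 then x else y / Real.sqrt 3 + q₀ i) D =
        MvPolynomial.eval (fun i : Fin 2 => if i = 0 then x ^ 2 + y ^ 2 else 3 * x ^ 2 * y - y ^ 3) c := by
  have hs0 : Real.sqrt 3 ≠ 0 := Real.sqrt_ne_zero'.2 (by norm_num)
  have hs : Real.sqrt 3 * Real.sqrt 3 = 3 := Real.mul_self_sqrt (by norm_num)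
  -- the planar restriction as a polynomial in `(x, y)`
  set b : MvPolynomial (Fin 2) ℝ := MvPolynomial.bind₁ (fun i : Fin 4 => if i = 0 then (MvPolynomial.X 0 : MvPolynomial (Fin 2) ℝ)
    else MvPolynomial.C (1 / Real.sqrt 3) * MvPolynomial.X 1 + MvPolynomial.C (q₀ i)) D with hb
  have hb_eval : ∀ v : Fin 2 → ℝ, MvPolynomial.eval v b =
      MvPolynomial.eval (fun i : Fin 4 => if i = 0 then v 0 else v 1 / Real.sqrt 3 + q₀ i) D := by
    intro v
    have key : MvPolynomial.eval v b = MvPolynomial.eval (fun i : Fin 4 => MvPolynomial.eval v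
        ((fun i : Fin 4 => if i = 0 then (MvPolynomial.X 0 : MvPolynomial (Fin 2) ℝ)
          else MvPolynomial.C (1 / Real.sqrt 3) * MvPolynomial.X 1 + MvPolynomial.C (q₀ i)) i)) D :=
      MvPolynomial.eval₂Hom_bind₁ _ _ _ _
    have hpt : (fun i : Fin 4 => MvPolynomial.eval v
        ((fun i : Fin 4 => if i = 0 then (MvPolynomial.X 0 : MvPolynomial (Fin 2) ℝ)
          else MvPolynomial.C (1 / Real.sqrt 3) * MvPolynomial.X 1 + MvPolynomial.C (q₀ i)) i)) =
        fun i : Fin 4 => if i = 0 then v 0 else v 1 / Real.sqrt 3 + q₀ i := by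
      funext i
      by_cases hi : i = 0
      · simp only [hi, if_true, MvPolynomial.eval_X]
      · simp only [hi, if_false, map_add, map_mul, MvPolynomial.eval_C, MvPolynomial.eval_X]
        ring
    rw [key, hpt]
  -- the sign change `ε₀`
  have hε0 : ∀ P : Fin 4 → ℝ, MvPolynomial.eval (fun i => if i = 0 then -P 0 else P i) D = MvPolynomial.eval P D := by
    intro P
    have h := hB4 (Equiv.refl _) (fun i => if i = 0 then -1 else 1)
      (fun i => by by_cases hi : i = 0 <;> simp [hi]) P
    have hpt : (fun i : Fin 4 => if i = 0 then -P 0 else P i) =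
        fun i : Fin 4 => (if i = 0 then (-1 : ℝ) else 1) * P ((Equiv.refl (Fin 4)) i) := by
      funext i
      by_cases hi : i = 0
      · simp [hi]
      · simp [hi]
    exact (congrArg (fun w => MvPolynomial.eval w D) hpt).trans h
  -- evenness in `x` (the sign change `ε₀`)
  have heven : ∀ v : Fin 2 → ℝ, MvPolynomial.eval (fun i => if i = 0 then -v 0 else v 1) b = MvPolynomial.eval v b := by
    intro v
    rw [hb_eval, hb_eval, if_pos rfl, if_neg (by decide : ¬ ((1 : Fin 2) = 0))]
    have hpt : (fun i : Fin 4 => if i = 0 then -v 0 else v 1 / Real.sqrt 3 + q₀ i) =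
        fun i : Fin 4 => if i = 0 then -(fun j : Fin 4 => if j = 0 then v 0 else v 1 / Real.sqrt 3 + q₀ j) 0
          else (fun j : Fin 4 => if j = 0 then v 0 else v 1 / Real.sqrt 3 + q₀ j) i := by
      funext i
      by_cases hi : i = 0
      · simp [hi]
      · simp [hi]
    rw [hpt]
    exact hε0 _
  -- invariance under the rotation by `120°` (the composite `s ∘ ε₀`)
  have hrot : ∀ v : Fin 2 → ℝ, MvPolynomial.eval
      (fun i => if i = 0 then -(1/2 : ℝ) * v 0 - (Real.sqrt 3 / 2) * v 1
        else (Real.sqrt 3 / 2) * v 0 - (1/2 : ℝ) * v 1) b = MvPolynomial.eval v b := by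
    intro v
    rw [hb_eval, hb_eval, if_pos rfl, if_neg (by decide : ¬ ((1 : Fin 2) = 0))]
    -- `w = ε₀ (x e₀ + y f + q₀)`
    set w : Fin 4 → ℝ := fun i => if i = 0 then -v 0 else v 1 / Real.sqrt 3 + q₀ i with hw
    have hw_eval : MvPolynomial.eval w D =
        MvPolynomial.eval (fun i : Fin 4 => if i = 0 then v 0 else v 1 / Real.sqrt 3 + q₀ i) D := by
      have hpt : w = fun i : Fin 4 => if i = 0 then -(fun j : Fin 4 => if j = 0 then v 0 else v 1 / Real.sqrt 3 + q₀ j) 0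
          else (fun j : Fin 4 => if j = 0 then v 0 else v 1 / Real.sqrt 3 + q₀ j) i := by
        funext i
        rw [hw]
        by_cases hi : i = 0
        · simp [hi]
        · simp [hi]
      rw [hpt]
      exact hε0 _
    have hsum : ∑ j, w j = -v 0 + Real.sqrt 3 * v 1 := by
      rw [Fin.sum_univ_four, hw]
      simp only [if_true, show (1 : Fin 4) ≠ 0 by decide, show (2 : Fin 4) ≠ 0 by decide, show (3 : Fin 4) ≠ 0 by decide,
        if_false]
      field_simp
      linear_combination hqs * Real.sqrt 3 - v 1 * hs
    have hpt : (fun i : Fin 4 => if i = 0 then -(1/2 : ℝ) * v 0 - (Real.sqrt 3 / 2) * v 1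
        else ((Real.sqrt 3 / 2) * v 0 - (1/2 : ℝ) * v 1) / Real.sqrt 3 + q₀ i) = fun i => w i - (∑ j, w j) / 2 := by
      funext i
      rw [hsum, hw]
      by_cases hi : i = 0
      · simp only [hi, if_true]; ring
      · simp only [hi, if_false]
        field_simp
        linear_combination (v 1) * hs
    rw [hpt, hhalf w, hw_eval]
  exact ⟨(dihedralChevalley b heven hrot).choose, fun x y => by
    have := (dihedralChevalley b heven hrot).choose_spec (fun i => if i = 0 then x else y)
    rw [hb_eval, if_pos rfl, if_neg (by decide : ¬ ((1 : Fin 2) = 0))] at this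
    simpa only [if_true, if_one_eq] using this⟩

/-- **Radial planar restrictions give the plane-rotation invariance** (plan §G): the conclusion is the skeleton's `PlaneRotInv D` with
`rotPlane` inlined (verbatim the hypothesis `hrot` of `radial_of_b4Inv_of_planeRotInv`). [folklore] -/
theorem planeRotInv_of_planar_radial (D : MvPolynomial (Fin 4) ℝ)
    (h : ∀ q₀ : Fin 4 → ℝ, q₀ 0 = 0 → q₀ 1 + q₀ 2 + q₀ 3 = 0 →
      ∃ F : Polynomial ℝ, ∀ x y : ℝ,
        MvPolynomial.eval (fun i : Fin 4 => if i = 0 then x else y / Real.sqrt 3 + q₀ i) D = F.eval (x ^ 2 + y ^ 2)) :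
    ∀ (φ : ℝ) (p : Fin 4 → ℝ), MvPolynomial.eval (fun i =>
      let a := p 0
      let b := (p 1 + p 2 + p 3) / Real.sqrt 3
      if i = 0 then Real.cos φ * a - Real.sin φ * b
      else p i + ((Real.sin φ * a + Real.cos φ * b) - b) / Real.sqrt 3) D = MvPolynomial.eval p D := by
  intro φ p
  have hs0 : Real.sqrt 3 ≠ 0 := Real.sqrt_ne_zero'.2 (by norm_num)
  have hs : Real.sqrt 3 * Real.sqrt 3 = 3 := Real.mul_self_sqrt (by norm_num)
  set x : ℝ := p 0 with hx
  set y : ℝ := (p 1 + p 2 + p 3) / Real.sqrt 3 with hy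
  set q₀ : Fin 4 → ℝ := fun i => if i = 0 then 0 else p i - y / Real.sqrt 3 with hq₀
  have hq00 : q₀ 0 = 0 := by rw [hq₀]; exact if_pos rfl
  have hqs : q₀ 1 + q₀ 2 + q₀ 3 = 0 := by
    rw [hq₀]
    simp only [show (1 : Fin 4) ≠ 0 by decide, show (2 : Fin 4) ≠ 0 by decide, show (3 : Fin 4) ≠ 0 by decide, if_false, hy]
    field_simp
    linear_combination (p 1 + p 2 + p 3) * hs
  obtain ⟨F, hF⟩ := h q₀ hq00 hqs
  -- `p` and `rotPlane φ p` in the planar frame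
  have hp : p = fun i : Fin 4 => if i = 0 then x else y / Real.sqrt 3 + q₀ i := by
    funext i
    by_cases hi : i = 0
    · rw [if_pos hi, hi]
    · rw [if_neg hi, hq₀]; simp only [hi, if_false]; ring
  have hrotp : (fun i : Fin 4 =>
      let a := p 0
      let b := (p 1 + p 2 + p 3) / Real.sqrt 3
      if i = 0 then Real.cos φ * a - Real.sin φ * b
      else p i + ((Real.sin φ * a + Real.cos φ * b) - b) / Real.sqrt 3) =
      fun i : Fin 4 => if i = 0 then (Real.cos φ * x - Real.sin φ * y)
        else (Real.sin φ * x + Real.cos φ * y) / Real.sqrt 3 + q₀ i := by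
    funext i
    by_cases hi : i = 0
    · simp only [hi, if_true, hx, hy]
    · simp only [hi, if_false, hq₀, hx, hy]; ring
  rw [hrotp, hF, hp, hF]
  congr 1
  nlinarith [Real.sin_sq_add_cos_sq φ]

end Summit.QuantumFields.YangMills.Theorems.RationalShortRootRigidity
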